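/-
Copyright (c) 2026. All rights reserved.
Released under Apache 2.0 license as described in the file LICENSE.
-/
import Literature.NumberTheory.Automorphic.DefiniteOrdersClassNumbersMass
import Literature.NumberTheory.Automorphic.DefiniteOrderUnitsNoncommutative
import HarnessLib

/-!
# Eichler's class number bounds for definite Eichler orders over `ℚ`: `mass ≤ # Cls O ≤ 3·mass`, and class number one forces
# `φ(N⁻) ψ(N⁺) ≤ 12` — so `q ≤ 13` for `q ∣ N⁻`, `p ≤ 11` and `p² ∤ N⁺` (`p ≥ 5`), `27 ∤ N⁺`, `16 ∤ N⁺` for the level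

[tag: quaternion_algebra] [tag: class_number] [tag: mass_formula]

Topic `NumberTheory/Automorphic`; THEOREMS ONLY (no definition, no named fact, no instance; net Literature debt `0`).
Lane `lit-hodgefound`, seat p12, gen 48 — consequences of Eichler's mass formula now that it is a theorem of the tree at every
level (`EichlerMassFormula.brandtModule_massFormula_holds`, in the form `Brandt.XiSetup.massFormula`:
`Σ_c 1/w_c = (1/12) ∏_{q∣N⁻}(q − 1) ∏_{p^k ∥ N⁺} p^{k−1}(p + 1) =: mass(N⁺, N⁻)` for every Brandt setup `S : XiSetup N⁺ N⁻`, i.e. every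
definite Eichler order `O` of level `N⁺` in the quaternion algebra of discriminant `N⁻` over `ℚ`). Since `1 ≤ w_c`
(`XiSetup.one_le_weight`) and, for `N⁻ ∉ {2, 3}`, `w_c ≤ 3` (`Brandt.XiSetup.weight_le_three`, Voight Exercise 25.5 (a)):

* **`Brandt.XiSetup.mass_le_natCard_classSet`** — EICHLER'S LOWER BOUND `mass(N⁺, N⁻) ≤ # Cls O` at every level, with the form in `ℕ`
  **`Brandt.XiSetup.prod_le_twelve_mul_natCard_classSet`** (`∏_{q∣N⁻}(q − 1) · ∏_{p^k∥N⁺} p^{k−1}(p + 1) ≤ 12 · # Cls O`) and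
  `Brandt.XiSetup.two_le_natCard_classSet_of_twelve_lt` (`12 < φ(N⁻)ψ(N⁺) ⟹ 2 ≤ # Cls O`);
* **`Brandt.XiSetup.natCard_classSet_le_three_mul_mass`** — the upper bound `# Cls O ≤ 3·mass(N⁺, N⁻) = ¼ φ(N⁻) ψ(N⁺)` for `N⁻ ∉ {2, 3}`;
* **CLASS NUMBER ONE IS A FINITE PROBLEM** (the first step of the classification of the definite Eichler orders over `ℚ` of class
  number one, Voight §25.4 ∕ Kirschmer–Voight): **`Brandt.XiSetup.prod_le_twelve_of_subsingleton`** (`# Cls O = 1 ⟹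
  ∏_{q∣N⁻}(q − 1) · ∏_{p^k∥N⁺} p^{k−1}(p + 1) ≤ 12`), hence **`…prime_le_thirteen_of_dvd_of_subsingleton`** (`q ∣ N⁻ ⟹ q ≤ 13`),
  **`…prime_le_eleven_of_dvd_of_subsingleton`** (`p ∣ N⁺ ⟹ p ≤ 11`), **`…factorization_le_one_of_subsingleton`** (`p ≥ 5 ⟹ p² ∤ N⁺`),
  `…factorization_three_le_two_of_subsingleton` (`27 ∤ N⁺`), `…factorization_two_le_three_of_subsingleton` (`16 ∤ N⁺`).

## Sources

* M. Eichler, *Zur Zahlentheorie der Quaternionen-Algebren*, J. reine angew. Math. 195 (1955), §4–§5 (Maßformel, `H ≥ M`).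
  [cite: Eichler1955, §4–§5]
* J. Voight, *Quaternion Algebras*, GTM 288 (2021), Thm. 25.3.18–25.3.19 (Eichler mass formula over `ℚ`), §25.4 and Remark 25.4.6
  (definite orders of class number one: «all definite quaternion orders of class number 1 have been determined»), Exercise 25.5 (a)
  (`w ≤ 3` for `disc B ∉ {2, 3}`), Thm. 26.1.5. [cite: Voight2021, Thm. 25.3.18; §25.4; Exercise 25.5 (a)]
* M.-F. Vignéras, *Arithmétique des algèbres de quaternions*, LNM 800 (1980), Ch. V §2 Cor. 2.3, §3 Prop. 3.1. [cite: VignerasLNM800, Ch. V §2 Cor. 2.3; §3 Prop. 3.1]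

## Scope (honest)

Theorems only. Inequalities from the mass formula and the unit bounds alone; the exact list of class-number-one levels (which needs
the unit groups ∕ the elliptic terms level by level, cf. `DefiniteEichlerOrdersClassNumberFormula`) is not derived here.
-/

noncomputable section

open Finset
open Literature.NumberTheory.Automorphic.Brandt

namespace Literature.NumberTheory.Automorphic

variable {Nplus Nminus : ℕ}

/-! ## §1 `mass ≤ h ≤ 3·mass` -/

/-- **EICHLER'S LOWER BOUND `mass(N⁺, N⁻) ≤ # Cls O`**: `(1/12) ∏_{q∣N⁻}(q − 1) ∏_{p^k∥N⁺} p^{k−1}(p + 1) = Σ_c 1/w_c ≤ Σ_c 1`.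
[cite: Eichler1955, §5] [cite: Voight2021, Thm. 25.3.18] -/
theorem Brandt.XiSetup.mass_le_natCard_classSet (S : XiSetup Nplus Nminus) :
    (1 / 12 : ℚ) * (∏ q ∈ Nminus.primeFactors, ((q : ℚ) - 1)) *
        ∏ p ∈ Nplus.primeFactors, (p : ℚ) ^ (Nplus.factorization p - 1) * ((p : ℚ) + 1) ≤
      Nat.card (ClassSet S.O) := by
  classical
  letI : Fintype (ClassSet S.O) := Fintype.ofFinite _
  rw [← S.massFormula, Nat.card_eq_fintype_card, ← Finset.card_univ, ← mul_one ((Finset.univ.card : ℕ) : ℚ),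
    ← nsmul_eq_mul, ← Finset.sum_const]
  refine Finset.sum_le_sum fun c _ => ?_
  have h1 : (1 : ℚ) ≤ weight S.O c := by exact_mod_cast S.one_le_weight c
  exact (div_le_one (by positivity)).mpr h1

/-- **`# Cls O ≤ 3 · mass(N⁺, N⁻) = ¼ φ(N⁻) ψ(N⁺)` for `N⁻ ∉ {2, 3}`** (then every `w_c ≤ 3`). [cite: Voight2021, Exercise 25.5 (a) and Thm. 25.3.18] [cite: VignerasLNM800, Ch. V §3 Prop. 3.1] -/
theorem Brandt.XiSetup.natCard_classSet_le_three_mul_mass (S : XiSetup Nplus Nminus) (h2 : Nminus ≠ 2) (h3 : Nminus ≠ 3) :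
    (Nat.card (ClassSet S.O) : ℚ) ≤
      3 * ((1 / 12 : ℚ) * (∏ q ∈ Nminus.primeFactors, ((q : ℚ) - 1)) *
        ∏ p ∈ Nplus.primeFactors, (p : ℚ) ^ (Nplus.factorization p - 1) * ((p : ℚ) + 1)) := by
  classical
  letI : Fintype (ClassSet S.O) := Fintype.ofFinite _
  rw [← S.massFormula, Finset.mul_sum, Nat.card_eq_fintype_card, ← Finset.card_univ,
    ← mul_one ((Finset.univ.card : ℕ) : ℚ), ← nsmul_eq_mul, ← Finset.sum_const]
  refine Finset.sum_le_sum fun c _ => ?_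
  have h3' : (weight S.O c : ℚ) ≤ 3 := by exact_mod_cast S.weight_le_three h2 h3 c
  have h0 : (0 : ℚ) < weight S.O c := by exact_mod_cast S.one_le_weight c
  rw [mul_one_div, le_div_iff₀ h0, one_mul]
  exact h3'

/-- The mass as a natural number divided by `12`: `12 · mass(N⁺, N⁻) = ∏_{q∣N⁻}(q − 1) · ∏_{p^k∥N⁺} p^{k−1}(p + 1)` (cast). [folklore] -/
private theorem twelve_mul_mass_eq' (Nplus Nminus : ℕ) :
    12 * ((1 / 12 : ℚ) * (∏ q ∈ Nminus.primeFactors, ((q : ℚ) - 1)) *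
        ∏ p ∈ Nplus.primeFactors, (p : ℚ) ^ (Nplus.factorization p - 1) * ((p : ℚ) + 1)) =
      (((∏ q ∈ Nminus.primeFactors, (q - 1)) * ∏ p ∈ Nplus.primeFactors, p ^ (Nplus.factorization p - 1) * (p + 1) : ℕ) : ℚ) := by
  have hq : ∀ q ∈ Nminus.primeFactors, ((q - 1 : ℕ) : ℚ) = (q : ℚ) - 1 := fun q hq =>
    Nat.cast_pred (Nat.prime_of_mem_primeFactors hq).pos
  push_cast
  rw [Finset.prod_congr rfl hq]
  ring

/-- **`∏_{q∣N⁻}(q − 1) · ∏_{p^k∥N⁺} p^{k−1}(p + 1) ≤ 12 · # Cls O`** (the lower bound in natural numbers). [cite: Eichler1955, §5] [cite: Voight2021, Thm. 25.3.18] -/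
theorem Brandt.XiSetup.prod_le_twelve_mul_natCard_classSet (S : XiSetup Nplus Nminus) :
    (∏ q ∈ Nminus.primeFactors, (q - 1)) * ∏ p ∈ Nplus.primeFactors, p ^ (Nplus.factorization p - 1) * (p + 1) ≤
      12 * Nat.card (ClassSet S.O) := by
  have h := S.mass_le_natCard_classSet
  have h12 := mul_le_mul_of_nonneg_left h (by norm_num : (0 : ℚ) ≤ 12)
  rw [twelve_mul_mass_eq'] at h12
  exact_mod_cast h12

/-- **`12 < φ(N⁻) ψ(N⁺) ⟹ 2 ≤ # Cls O`.** [cite: Eichler1955, §5] [cite: Voight2021, Thm. 25.3.18] -/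
theorem Brandt.XiSetup.two_le_natCard_classSet_of_twelve_lt (S : XiSetup Nplus Nminus)
    (h : 12 < (∏ q ∈ Nminus.primeFactors, (q - 1)) * ∏ p ∈ Nplus.primeFactors, p ^ (Nplus.factorization p - 1) * (p + 1)) :
    2 ≤ Nat.card (ClassSet S.O) := by
  have h' := S.prod_le_twelve_mul_natCard_classSet
  omega

/-! ## §2 Class number one is a finite problem: `φ(N⁻) ψ(N⁺) ≤ 12` -/

/-- **`# Cls O = 1 ⟹ ∏_{q∣N⁻}(q − 1) · ∏_{p^k∥N⁺} p^{k−1}(p + 1) ≤ 12`** — a definite Eichler order over `ℚ` of class number one has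
`φ(N⁻) ψ(N⁺) ≤ 12`; in particular there are only finitely many levels `(N⁺, N⁻)` of class number one. [cite: Voight2021, §25.4 and Remark 25.4.6] [cite: Eichler1955, §5] -/
theorem Brandt.XiSetup.prod_le_twelve_of_subsingleton (S : XiSetup Nplus Nminus) [Subsingleton (ClassSet S.O)] :
    (∏ q ∈ Nminus.primeFactors, (q - 1)) * ∏ p ∈ Nplus.primeFactors, p ^ (Nplus.factorization p - 1) * (p + 1) ≤ 12 := by
  have h := S.prod_le_twelve_mul_natCard_classSet
  have h1 : Nat.card (ClassSet S.O) ≤ 1 := Finite.card_le_one_iff_subsingleton.mpr ‹_›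
  calc _ ≤ 12 * Nat.card (ClassSet S.O) := h
    _ ≤ 12 * 1 := Nat.mul_le_mul_left 12 h1
    _ = 12 := rfl

/-- Each local factor `p^{k−1}(p + 1)` of `ψ` is `≥ 1`. [folklore] -/
private theorem one_le_psiFactor' (N p : ℕ) : 1 ≤ p ^ (N.factorization p - 1) * (p + 1) := by
  rcases Nat.eq_zero_or_pos p with rfl | hp
  · rw [Nat.factorization_zero_right, Nat.zero_sub, pow_zero, one_mul, zero_add]
  · exact Nat.one_le_iff_ne_zero.mpr (mul_ne_zero (pow_ne_zero _ hp.ne') (Nat.succ_ne_zero p))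

/-- **`# Cls O = 1 ⟹ q ≤ 13` for every prime `q ∣ N⁻`** (`q − 1 ≤ φ(N⁻) ψ(N⁺) ≤ 12`). [cite: Voight2021, §25.4 and Thm. 25.4.1] -/
theorem Brandt.XiSetup.prime_le_thirteen_of_dvd_of_subsingleton (S : XiSetup Nplus Nminus) [Subsingleton (ClassSet S.O)]
    {q : ℕ} (hq : q.Prime) (hqN : q ∣ Nminus) : q ≤ 13 := by
  have h := S.prod_le_twelve_of_subsingleton
  have hmem : q ∈ Nminus.primeFactors := Nat.mem_primeFactors.mpr ⟨hq, hqN, S.squarefree.ne_zero⟩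
  have h1 : q - 1 ≤ ∏ q ∈ Nminus.primeFactors, (q - 1) :=
    Finset.single_le_prod' (f := fun r => r - 1)
      (fun r hr => Nat.sub_pos_of_lt (Nat.prime_of_mem_primeFactors hr).one_lt) hmem
  have h2 : 1 ≤ ∏ p ∈ Nplus.primeFactors, p ^ (Nplus.factorization p - 1) * (p + 1) :=
    Finset.one_le_prod' fun p _ => one_le_psiFactor' Nplus p
  have h3 : q - 1 ≤ 12 := by
    calc q - 1 ≤ (∏ q ∈ Nminus.primeFactors, (q - 1)) * 1 := by rw [mul_one]; exact h1
      _ ≤ (∏ q ∈ Nminus.primeFactors, (q - 1)) * ∏ p ∈ Nplus.primeFactors, p ^ (Nplus.factorization p - 1) * (p + 1) :=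
          Nat.mul_le_mul_left _ h2
      _ ≤ 12 := h
  omega

/-- The `p`-factor of `ψ(N⁺)` is bounded by `12` in class number one. [cite: Voight2021, §25.4] -/
private theorem psiFactor_le_twelve' (S : XiSetup Nplus Nminus) [Subsingleton (ClassSet S.O)] {p : ℕ} (hp : p.Prime)
    (hpN : p ∣ Nplus) : p ^ (Nplus.factorization p - 1) * (p + 1) ≤ 12 := by
  have h := S.prod_le_twelve_of_subsingleton
  have hmem : p ∈ Nplus.primeFactors := Nat.mem_primeFactors.mpr ⟨hp, hpN, S.nplus_pos.ne'⟩
  have h1 : p ^ (Nplus.factorization p - 1) * (p + 1) ≤ ∏ p ∈ Nplus.primeFactors, p ^ (Nplus.factorization p - 1) * (p + 1) :=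
    Finset.single_le_prod' (f := fun r => r ^ (Nplus.factorization r - 1) * (r + 1))
      (fun r _ => one_le_psiFactor' Nplus r) hmem
  have h2 : 1 ≤ ∏ q ∈ Nminus.primeFactors, (q - 1) :=
    Finset.one_le_prod' fun r hr => Nat.sub_pos_of_lt (Nat.prime_of_mem_primeFactors hr).one_lt
  calc p ^ (Nplus.factorization p - 1) * (p + 1)
      ≤ 1 * ∏ p ∈ Nplus.primeFactors, p ^ (Nplus.factorization p - 1) * (p + 1) := by rw [one_mul]; exact h1
    _ ≤ (∏ q ∈ Nminus.primeFactors, (q - 1)) * ∏ p ∈ Nplus.primeFactors, p ^ (Nplus.factorization p - 1) * (p + 1) :=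
        Nat.mul_le_mul_right _ h2
    _ ≤ 12 := h

/-- **`# Cls O = 1 ⟹ p ≤ 11` for every prime `p ∣ N⁺`** (`p + 1 ≤ p^{k−1}(p + 1) ≤ 12`). [cite: Voight2021, §25.4 and Remark 25.4.6] -/
theorem Brandt.XiSetup.prime_le_eleven_of_dvd_of_subsingleton (S : XiSetup Nplus Nminus) [Subsingleton (ClassSet S.O)]
    {p : ℕ} (hp : p.Prime) (hpN : p ∣ Nplus) : p ≤ 11 := by
  have h := psiFactor_le_twelve' S hp hpN
  have h1 : p + 1 ≤ p ^ (Nplus.factorization p - 1) * (p + 1) :=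
    Nat.le_mul_of_pos_left _ (pow_pos hp.pos _)
  omega

/-- **`# Cls O = 1 ⟹ p² ∤ N⁺` for every prime `p ≥ 5`** (`p(p + 1) ≥ 30 > 12`): `v_p(N⁺) ≤ 1`. [cite: Voight2021, §25.4 and Remark 25.4.6] -/
theorem Brandt.XiSetup.factorization_le_one_of_subsingleton (S : XiSetup Nplus Nminus) [Subsingleton (ClassSet S.O)]
    {p : ℕ} (hp : p.Prime) (h5 : 5 ≤ p) : Nplus.factorization p ≤ 1 := by
  by_contra hk
  have hk2 : 2 ≤ Nplus.factorization p := by omega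
  have hpN : p ∣ Nplus := Nat.dvd_of_factorization_pos (by omega)
  have h := psiFactor_le_twelve' S hp hpN
  have h1 : p ^ 1 ≤ p ^ (Nplus.factorization p - 1) := Nat.pow_le_pow_right hp.pos (by omega)
  rw [pow_one] at h1
  have h2 : p * (p + 1) ≤ p ^ (Nplus.factorization p - 1) * (p + 1) := Nat.mul_le_mul_right _ h1
  nlinarith

/-- **`# Cls O = 1 ⟹ 27 ∤ N⁺`** (`9 · 4 = 36 > 12`): `v₃(N⁺) ≤ 2`. [cite: Voight2021, §25.4 and Remark 25.4.6] -/
theorem Brandt.XiSetup.factorization_three_le_two_of_subsingleton (S : XiSetup Nplus Nminus) [Subsingleton (ClassSet S.O)] :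
    Nplus.factorization 3 ≤ 2 := by
  by_contra hk
  have hk3 : 3 ≤ Nplus.factorization 3 := by omega
  have hpN : 3 ∣ Nplus := Nat.dvd_of_factorization_pos (by omega)
  have h := psiFactor_le_twelve' S Nat.prime_three hpN
  have h1 : 3 ^ 2 ≤ 3 ^ (Nplus.factorization 3 - 1) := Nat.pow_le_pow_right (by norm_num) (by omega)
  have h2 : 3 ^ 2 * (3 + 1) ≤ 3 ^ (Nplus.factorization 3 - 1) * (3 + 1) := Nat.mul_le_mul_right _ h1
  omega

/-- **`# Cls O = 1 ⟹ 16 ∤ N⁺`** (`8 · 3 = 24 > 12`): `v₂(N⁺) ≤ 3`. [cite: Voight2021, §25.4 and Remark 25.4.6] -/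
theorem Brandt.XiSetup.factorization_two_le_three_of_subsingleton (S : XiSetup Nplus Nminus) [Subsingleton (ClassSet S.O)] :
    Nplus.factorization 2 ≤ 3 := by
  by_contra hk
  have hk4 : 4 ≤ Nplus.factorization 2 := by omega
  have hpN : 2 ∣ Nplus := Nat.dvd_of_factorization_pos (by omega)
  have h := psiFactor_le_twelve' S Nat.prime_two hpN
  have h1 : 2 ^ 3 ≤ 2 ^ (Nplus.factorization 2 - 1) := Nat.pow_le_pow_right (by norm_num) (by omega)
  have h2 : 2 ^ 3 * (2 + 1) ≤ 2 ^ (Nplus.factorization 2 - 1) * (2 + 1) := Nat.mul_le_mul_right _ h1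
  omega

end Literature.NumberTheory.Automorphic

end
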